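import Mathlib
import Summits.NavierStokesRegularity.NavierStokesRegularity.Theorems.TaoLadderRungTwoFlatCaptureContinuity
import Summits.NavierStokesRegularity.NavierStokesRegularity.Theorems.TaoLadderRungTwoFlatTableContinuityOn
import Summits.NavierStokesRegularity.NavierStokesRegularity.Theorems.TaoLadderRungTwoFlatCertificateGlueExistOn
import HarnessLib

/-!
# THE GRADED FLOW OF A FLAT-PULSE DATUM: a-priori-free gauge deviation from the flat trajectory, and EXISTENCE on a clock window
  (referee c98 A-128: a producer for the pulse-flow hypothesis `hU` of `tubeStep_of_schedule_split`)
  (helper for the K_A♭ parent item stmt-NavierStokesRegularity-22987 `FlatGapCertificatesV2`, child 2A `GradedAdiabaticWakeA` of route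
  TaoLadderRungTwoFlat; cell harvest/h2-tao-ladder, p1 g25; LADDER §46–§48 (renormalised frame), §64 (TRAP #25 (α)))

`tubeStep_of_schedule_split` (p727068) reads the reference family off ONE exact GRADED flow `U` of the pulse state `u⋆` on `[0, τ_U] ⊇ [0, c₀]`
(`hU`); child 1 supplies the FLAT pulse `Φ` (a solution of the ratio-`0` mirror lattice). In the renormalised amplitudes `X = c·S`
(`c_k = (1+ε₀)^{5k/2}`) an exact graded flow is an exact ratio-`0` flow of the renormalised table `α̃` (`RenormFrame.pseudoFlowOnShift_renorm`),
`‖α̃ − α‖₁ = O(ε₀)` (`…RatioContinuity`), so the window table-continuity `QuadPolar.gauge_abs_sub_le_of_tables_Icc` bounds `w|c·S − Φ|` —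
CONDITIONALLY on a plain sup bound of `c·S`. As in `…CaptureContinuity` that condition is removed by continuous induction on a finite sup
((4.5) makes `c|S| ≤ M_Φ + 1` automatic off a finite set of shells). Feeding the resulting weighted bound to the continuation criterion
`exists_exact_pseudoFlowOnShift_of_apriori_bound` (via `CertificateGlueOn.pseudoFlowOnShift_of_conjugated`) gives the graded flow on the whole
window.

* `gauge_deviation_graded_vs_flat` — exact graded flow `S` vs flat window solution `Φ` on `[0, τ]`: `w|c·S − Φ|(s) ≤ (B_D + ‖α̃−α‖₁(M_Φ+1)ΛM_w s)·
  e^{2‖α̃‖₁(M_Φ+1)Λs}` for a window-regular gauge `w ≥ 1` with `w|Φ| ≤ M_w`, `|Φ| ≤ M_Φ`, `w|c·S₀ − Φ(0)| ≤ B_D`, under the smallness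
  "that bound at `s = τ` is `≤ ½`";
* `exists_gradedFlow_of_flat` — for an admissible Banach weight `ω ≤ c·w`: the exact graded flow from `S₀` EXISTS on `[0, c]`, with
  `ω_k|S_{ik}(t)| ≤ M_w + ½`.

HONEST FRAMING: finite-time estimates and a soft existence statement about MODEL-lattice flows (graded mirror table on `S♭`); the flat trajectory,
its bounds and the smallness are HYPOTHESES; nothing certified; no item closed; nothing about the Navier–Stokes equations.
-/

noncomputable section

-- the sub-problem namespace repeats the summit name by design (D-0017)
set_option linter.dupNamespace false

namespace Summit.NavierStokesRegularity.NavierStokesRegularity.Theorems.HopTube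

open Set Finset Filter BoundedContinuousFunction Literature.Analysis.FluidPDE Literature.Analysis.FluidPDE.TaoCascade MirrorPulse
  RenormFrame QuadPolar GappedFrontRobustOn CertificateGlueOn

/-- **A-PRIORI-FREE GAUGE DEVIATION OF AN EXACT GRADED FLOW FROM A FLAT WINDOW SOLUTION.** See the module docstring.
[cite: Tao2016AveragedNS, §4 Lemma 4.1 (4.5), (4.8), §5 (continuity argument), §6.4 (rescaled system); route TaoLadderRungTwoFlat, renormalised frame (cell LADDER §46–§48, §64)] -/
theorem gauge_deviation_graded_vs_flat {ε ε₀ τ : ℝ} {S₀ : Fin 2 → ℤ → ℝ} {S FS Φ : Fin 2 → ℤ → ℝ → ℝ}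
    (hS : PseudoFlowOnShift shiftSetFlat τ ε₀ (mirrorTable ε ε) 0 0 S₀ (fun i k => (1 / 2) * S₀ i k ^ 2)
      (fun _ _ => 0) S FS)
    (hε₀ : 0 < ε₀) (hτ : 0 ≤ τ)
    (hΦc : ∀ i n, ContinuousOn (Φ i n) (Icc 0 τ))
    (hΦd : ∀ i n, ∀ t ∈ Ioo 0 τ, HasDerivAt (Φ i n) (quadTermOn shiftSetFlat 0 (mirrorTable ε ε) Φ i n t) t)
    {w : Fin 2 → ℤ → ℝ} {Λ MΦ Mw BD : ℝ} (hw : IsWindowRegular w Λ) (hw1 : ∀ i n, 1 ≤ w i n) (hMΦ : 0 ≤ MΦ) (hMw : 0 ≤ Mw)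
    (hΦb : ∀ i n, ∀ t ∈ Icc 0 τ, |Φ i n t| ≤ MΦ) (hΦg : ∀ i n, ∀ t ∈ Icc 0 τ, w i n * |Φ i n t| ≤ Mw)
    (hBD : ∀ i n, w i n * |clockW ε₀ n * S₀ i n - Φ i n 0| ≤ BD)
    (hsmall : (BD + tableAbsSum shiftSetFlat (renormTable ε₀ (mirrorTable ε ε) - mirrorTable ε ε) * (MΦ + 1) * Λ * Mw * τ)
      * Real.exp (2 * tableAbsSum shiftSetFlat (renormTable ε₀ (mirrorTable ε ε)) * (MΦ + 1) * Λ * τ) ≤ 1 / 2) :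
    ∀ (i : Fin 2) (n : ℤ), ∀ s ∈ Icc 0 τ, w i n * |clockW ε₀ n * S i n s - Φ i n s|
      ≤ (BD + tableAbsSum shiftSetFlat (renormTable ε₀ (mirrorTable ε ε) - mirrorTable ε ε) * (MΦ + 1) * Λ * Mw * s)
          * Real.exp (2 * tableAbsSum shiftSetFlat (renormTable ε₀ (mirrorTable ε ε)) * (MΦ + 1) * Λ * s) := by
  have hε' : (-1 : ℝ) < ε₀ := by linarith
  have hc : ∀ k, 0 < clockW ε₀ k := clockW_pos hε'
  have hΛ1 : 1 ≤ Λ := hw.2.1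
  have hwpos : ∀ i n, 0 < w i n := hw.1
  have hT0 : 0 ≤ tableAbsSum shiftSetFlat (renormTable ε₀ (mirrorTable ε ε)) := tableAbsSum_nonneg _ _
  have hTd0 : 0 ≤ tableAbsSum shiftSetFlat (renormTable ε₀ (mirrorTable ε ε) - mirrorTable ε ε) := tableAbsSum_nonneg _ _
  have hL0 : 0 ≤ 2 * tableAbsSum shiftSetFlat (renormTable ε₀ (mirrorTable ε ε)) * (MΦ + 1) * Λ := by
    have : 0 ≤ Λ := zero_le_one.trans hΛ1
    positivity
  have hF0 : 0 ≤ tableAbsSum shiftSetFlat (renormTable ε₀ (mirrorTable ε ε) - mirrorTable ε ε) * (MΦ + 1) * Λ * Mw := by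
    have : 0 ≤ Λ := zero_le_one.trans hΛ1
    positivity
  have hBD0 : 0 ≤ BD := le_trans (mul_nonneg (hwpos 0 0).le (abs_nonneg _)) (hBD 0 0)
  -- the bound is monotone in `s`
  have hEmono : ∀ s, 0 ≤ s → s ≤ τ →
      (BD + tableAbsSum shiftSetFlat (renormTable ε₀ (mirrorTable ε ε) - mirrorTable ε ε) * (MΦ + 1) * Λ * Mw * s)
          * Real.exp (2 * tableAbsSum shiftSetFlat (renormTable ε₀ (mirrorTable ε ε)) * (MΦ + 1) * Λ * s) ≤ 1 / 2 := by
    intro s hs0 hsτ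
    refine le_trans ?_ hsmall
    exact mul_le_mul (by nlinarith) (Real.exp_le_exp.mpr (mul_le_mul_of_nonneg_left hsτ hL0)) (Real.exp_pos _).le
      (by nlinarith)
  -- the renormalised flow
  have hX := pseudoFlowOnShift_renorm hε₀.le hS
  have hXc : ∀ i n, ContinuousOn (renormFam ε₀ S i n) (Icc 0 τ) := fun i n => continuousOn_of_pseudoFlowOnShift hX i n
  -- the finite set of shells where `|c S| ≤ MΦ + 1` is not automatic
  have hMc : 0 < MΦ + 1 := by linarith
  obtain ⟨k₀, hk₀0, hk₀⟩ := R54.clockW_abs_eventually_le hS hε₀ hMc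
  obtain ⟨kl, hkl0, hkl⟩ := clockW_abs_le_behind hS hε₀ hMc
  set I : Finset (Fin 2 × ℤ) := Finset.univ ×ˢ Finset.Icc kl k₀ with hI
  have hIne : I.Nonempty := ⟨(0, 0), by simp only [hI, Finset.mem_product, Finset.mem_univ, Finset.mem_Icc, true_and]; omega⟩
  set f : ℝ → ℝ := fun t => I.sup' hIne (fun p => clockW ε₀ p.2 * |S p.1 p.2 t|) with hf
  have hScont : ∀ i k, ContinuousOn (S i k) (Icc 0 τ) := fun i k => continuousOn_of_pseudoFlowOnShift hS i k
  have hfcont : ContinuousOn f (Icc 0 τ) :=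
    ContinuousOn.finset_sup'_apply hIne fun p _ => continuousOn_const.mul (hScont p.1 p.2).abs
  have hall : ∀ t, t ≤ τ → (∀ s ∈ Icc 0 t, f s ≤ MΦ + 1) →
      ∀ (i : Fin 2) (k : ℤ), ∀ s ∈ Icc 0 t, clockW ε₀ k * |S i k s| ≤ MΦ + 1 := by
    intro t htτ hft i k s hs
    have hsτ : s ∈ Icc 0 τ := ⟨hs.1, hs.2.trans htτ⟩
    rcases lt_or_ge k₀ k with hk | hk
    · exact hk₀ k hk i s hsτ
    rcases lt_or_ge k kl with hk' | hk'
    · exact hkl k hk' i s hsτ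
    · have hp : (i, k) ∈ I := by
        simp only [hI, Finset.mem_product, Finset.mem_univ, Finset.mem_Icc, true_and]; exact ⟨hk', hk⟩
      exact (Finset.le_sup' (fun p : Fin 2 × ℤ => clockW ε₀ p.2 * |S p.1 p.2 s|) hp).trans (hft s hs)
  -- the conditional table-continuity on an initial segment `[0, t]`
  have hgron : ∀ t, 0 < t → t ≤ τ → (∀ (i : Fin 2) (k : ℤ), ∀ s ∈ Icc 0 t, clockW ε₀ k * |S i k s| ≤ MΦ + 1) →
      ∀ (i : Fin 2) (n : ℤ), ∀ s ∈ Icc 0 t, w i n * |clockW ε₀ n * S i n s - Φ i n s|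
        ≤ (BD + tableAbsSum shiftSetFlat (renormTable ε₀ (mirrorTable ε ε) - mirrorTable ε ε) * (MΦ + 1) * Λ * Mw * s)
          * Real.exp (2 * tableAbsSum shiftSetFlat (renormTable ε₀ (mirrorTable ε ε)) * (MΦ + 1) * Λ * s) := by
    intro t ht htτ hSb i n s hs
    have hX' := pseudoFlowOnShift_renorm hε₀.le (pseudoFlowOnShift_mono hS ht htτ)
    have hXc' : ∀ j m, ContinuousOn (renormFam ε₀ S j m) (Icc 0 t) := fun j m => continuousOn_of_pseudoFlowOnShift hX' j m
    have hXd' : ∀ j m, ∀ u ∈ Ioo 0 t, HasDerivAt (renormFam ε₀ S j m)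
        (quadTermOn shiftSetFlat 0 (renormTable ε₀ (mirrorTable ε ε)) (renormFam ε₀ S) j m u) u :=
      fun j m u hu => hasDerivAt_of_pseudoFlowOnShift_exact hX' j m hu
    have hXb' : ∀ j m, ∀ u ∈ Icc 0 t, |renormFam ε₀ S j m u| ≤ MΦ + 1 := fun j m u hu => by
      simp only [renormFam, abs_mul, abs_of_pos (hc m)]; exact hSb j m u hu
    have hΦc' : ∀ j m, ContinuousOn (Φ j m) (Icc 0 t) := fun j m => (hΦc j m).mono (Icc_subset_Icc_right htτ)
    have hΦd' : ∀ j m, ∀ u ∈ Ioo 0 t, HasDerivAt (Φ j m) (quadTermOn shiftSetFlat 0 (mirrorTable ε ε) Φ j m u) u :=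
      fun j m u hu => hΦd j m u ⟨hu.1, hu.2.trans_le htτ⟩
    have hΦb' : ∀ j m, ∀ u ∈ Icc 0 t, |Φ j m u| ≤ MΦ + 1 := fun j m u hu =>
      (hΦb j m u ⟨hu.1, hu.2.trans htτ⟩).trans (by linarith)
    have hΦg' : ∀ j m, ∀ u ∈ Icc 0 t, w j m * |Φ j m u| ≤ Mw := fun j m u hu => hΦg j m u ⟨hu.1, hu.2.trans htτ⟩
    have hBD' : ∀ j m, w j m * |renormFam ε₀ S j m 0 - Φ j m 0| ≤ BD := fun j m => by
      simp only [renormFam, hS.init_S]; exact hBD j m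
    have h := gauge_abs_sub_le_of_tables_Icc isNearestNeighbourSet_shiftSetFlat (renormTable ε₀ (mirrorTable ε ε)) (mirrorTable ε ε)
      hw hXc' hΦc' hXd' hΦd' hXb' hΦb' hMw hΦg' hBD' i n hs
    simpa only [renormFam] using h
  -- initial plain bound
  have hinit : ∀ (i : Fin 2) (k : ℤ), clockW ε₀ k * |S i k 0| ≤ MΦ + 1 / 2 := by
    intro i k
    rw [hS.init_S]
    have hΦ0 := hΦb i k 0 ⟨le_rfl, hτ⟩
    have h1 : |clockW ε₀ k * S₀ i k - Φ i k 0| ≤ BD :=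
      (le_mul_of_one_le_left (abs_nonneg _) (hw1 i k)).trans (hBD i k)
    have hB2 : BD ≤ 1 / 2 := by
      have := hEmono 0 le_rfl hτ
      rw [mul_zero, add_zero, mul_zero, Real.exp_zero, mul_one] at this
      exact this
    have htri := abs_sub_abs_le_abs_sub (clockW ε₀ k * S₀ i k) (Φ i k 0)
    rw [abs_mul, abs_of_pos (hc k)] at htri
    linarith
  -- continuous induction on the finite sup
  have hboot := Bootstrap.Icc_induction (f := f) (a := MΦ + 1) (b := MΦ + 1 / 2) hτ hfcont (by linarith)
    (Finset.sup'_le hIne _ fun p _ => hinit p.1 p.2) (by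
      intro t ht hft
      refine Finset.sup'_le hIne _ fun p _ => ?_
      rcases eq_or_lt_of_le ht.1 with h0 | htpos
      · rw [← h0]; exact hinit p.1 p.2
      · have hSb := hall t ht.2 hft
        have hd := hgron t htpos ht.2 hSb p.1 p.2 t ⟨ht.1, le_rfl⟩
        have hΦt := hΦb p.1 p.2 t ht
        have h2 : |clockW ε₀ p.2 * S p.1 p.2 t - Φ p.1 p.2 t| ≤ 1 / 2 :=
          ((le_mul_of_one_le_left (abs_nonneg _) (hw1 p.1 p.2)).trans hd).trans (hEmono t ht.1 ht.2)
        have htri := abs_sub_abs_le_abs_sub (clockW ε₀ p.2 * S p.1 p.2 t) (Φ p.1 p.2 t)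
        rw [abs_mul, abs_of_pos (hc p.2)] at htri
        linarith)
  -- conclusion
  intro i n s hs
  rcases eq_or_lt_of_le hτ with h0 | hτpos
  · have hs0 : s = 0 := le_antisymm (h0 ▸ hs.2) hs.1
    subst hs0
    rw [hS.init_S, mul_zero, add_zero, mul_zero, Real.exp_zero, mul_one]
    exact hBD i n
  · exact hgron τ hτpos le_rfl (hall τ le_rfl fun s hs => (hboot s hs).trans (by linarith)) i n s hs

/-- **EXISTENCE OF THE GRADED FLOW FROM A FLAT-TRAJECTORY DATUM ON A CLOCK WINDOW** (A-128). With an admissible Banach weight `ω ≤ c·w`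
(`w` the comparison gauge), the exact graded flow from `S₀` exists on `[0, c]` and obeys `ω_k|S_{ik}(t)| ≤ M_w + ½`; in particular the
pulse-flow hypothesis `hU` of `tubeStep_of_schedule_split` follows from child 1's flat pulse and the smallness of `ε₀`.
[cite: Tao2016AveragedNS, §4 Lemma 4.1 (4.5), (4.8)–(4.10) with (4.12); Teschl2012, Cor. 2.16; route TaoLadderRungTwoFlat, (α) reference family (cell LADDER §64), referee c98 A-128] -/
theorem exists_gradedFlow_of_flat {ε ε₀ c A Mα Dω : ℝ} {S₀ : Fin 2 → ℤ → ℝ} {Φ : Fin 2 → ℤ → ℝ → ℝ} {ω : ℤ → ℝ}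
    (hε₀ : 0 < ε₀) (hc : 0 < c) (hω : WeightRatiosLEOn shiftSetFlat ε₀ ω A) (hA : 0 ≤ A) (hMα : 0 ≤ Mα)
    (hα : ∀ i₁ i₂ i₃ μ, |mirrorTable ε ε i₁ i₂ i₃ μ| ≤ Mα) (hD : ∀ k : ℤ, (1 + (1 + ε₀) ^ ((10 : ℝ) * k)) / ω k ≤ Dω)
    (hΦc : ∀ i n, ContinuousOn (Φ i n) (Icc 0 c))
    (hΦd : ∀ i n, ∀ t ∈ Ioo 0 c, HasDerivAt (Φ i n) (quadTermOn shiftSetFlat 0 (mirrorTable ε ε) Φ i n t) t)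
    {w : Fin 2 → ℤ → ℝ} {Λ MΦ Mw BD : ℝ} (hw : IsWindowRegular w Λ) (hw1 : ∀ i n, 1 ≤ w i n) (hMΦ : 0 ≤ MΦ) (hMw : 0 ≤ Mw)
    (hωw : ∀ (i : Fin 2) (k : ℤ), ω k ≤ clockW ε₀ k * w i k)
    (hΦb : ∀ i n, ∀ t ∈ Icc 0 c, |Φ i n t| ≤ MΦ) (hΦg : ∀ i n, ∀ t ∈ Icc 0 c, w i n * |Φ i n t| ≤ Mw)
    (hBD : ∀ i n, w i n * |clockW ε₀ n * S₀ i n - Φ i n 0| ≤ BD)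
    (hsmall : (BD + tableAbsSum shiftSetFlat (renormTable ε₀ (mirrorTable ε ε) - mirrorTable ε ε) * (MΦ + 1) * Λ * Mw * c)
      * Real.exp (2 * tableAbsSum shiftSetFlat (renormTable ε₀ (mirrorTable ε ε)) * (MΦ + 1) * Λ * c) ≤ 1 / 2) :
    ∃ U FU : Fin 2 → ℤ → ℝ → ℝ,
      PseudoFlowOnShift shiftSetFlat c ε₀ (mirrorTable ε ε) 0 0 S₀ (fun i k => (1 / 2) * S₀ i k ^ 2) (fun _ _ => 0) U FU ∧
        ∀ t ∈ Icc 0 c, ∀ (i : Fin 2) (k : ℤ), ω k * |U i k t| ≤ Mw + 1 / 2 := by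
  have hε : 0 ≤ 1 + ε₀ := by linarith
  have hε' : (-1 : ℝ) < ε₀ := by linarith
  have hcpos : ∀ k, 0 < clockW ε₀ k := clockW_pos hε'
  have hωpos : ∀ k, 0 < ω k := hω.1
  have hL0 : 0 ≤ 2 * tableAbsSum shiftSetFlat (renormTable ε₀ (mirrorTable ε ε)) * (MΦ + 1) * Λ := by
    have : 0 ≤ Λ := zero_le_one.trans hw.2.1
    have := tableAbsSum_nonneg shiftSetFlat (renormTable ε₀ (mirrorTable ε ε))
    positivity
  have hF0 : 0 ≤ tableAbsSum shiftSetFlat (renormTable ε₀ (mirrorTable ε ε) - mirrorTable ε ε) * (MΦ + 1) * Λ * Mw := by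
    have : 0 ≤ Λ := zero_le_one.trans hw.2.1
    have := tableAbsSum_nonneg shiftSetFlat (renormTable ε₀ (mirrorTable ε ε) - mirrorTable ε ε)
    positivity
  have hBD0 : 0 ≤ BD := le_trans (mul_nonneg (hw.1 0 0).le (abs_nonneg _)) (hBD 0 0)
  -- from the weighted deviation `≤ ½` to the Banach bound
  have hkey : ∀ (t : ℝ) (i : Fin 2) (k : ℤ) (x : ℝ), t ∈ Icc 0 c → w i k * |clockW ε₀ k * x - Φ i k t| ≤ 1 / 2 →
      ω k * |x| ≤ Mw + 1 / 2 := by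
    intro t i k x ht hdev
    have h1 : ω k * |x| ≤ w i k * (clockW ε₀ k * |x|) := by
      rw [← mul_assoc, mul_comm (w i k)]; exact mul_le_mul_of_nonneg_right (hωw i k) (abs_nonneg _)
    have htri := abs_sub_abs_le_abs_sub (clockW ε₀ k * x) (Φ i k t)
    rw [abs_mul, abs_of_pos (hcpos k)] at htri
    have h2 : w i k * (clockW ε₀ k * |x|) ≤ w i k * |Φ i k t| + w i k * |clockW ε₀ k * x - Φ i k t| := by
      rw [← mul_add]; exact mul_le_mul_of_nonneg_left (by linarith) (hw.1 i k).le
    linarith [hΦg i k t ht]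
  have hBDhalf : BD ≤ 1 / 2 := by
    have h1 : BD ≤ (BD + tableAbsSum shiftSetFlat (renormTable ε₀ (mirrorTable ε ε) - mirrorTable ε ε) * (MΦ + 1) * Λ * Mw * c)
        * Real.exp (2 * tableAbsSum shiftSetFlat (renormTable ε₀ (mirrorTable ε ε)) * (MΦ + 1) * Λ * c) := by
      have he : 1 ≤ Real.exp (2 * tableAbsSum shiftSetFlat (renormTable ε₀ (mirrorTable ε ε)) * (MΦ + 1) * Λ * c) :=
        Real.one_le_exp (mul_nonneg hL0 hc.le)
      nlinarith [mul_nonneg hF0 hc.le]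
    exact h1.trans hsmall
  have hB₀ : ∀ (i : Fin 2) (k : ℤ), ω k * |S₀ i k| ≤ Mw + 1 / 2 := fun i k =>
    hkey 0 i k (S₀ i k) ⟨le_rfl, hc.le⟩ ((hBD i k).trans hBDhalf)
  have hBnn : 0 ≤ Mw + 1 / 2 := by linarith
  obtain ⟨T₀, hT₀, hT₀B⟩ := exists_weightedState hBnn S₀ hB₀ hωpos
  obtain ⟨U, hU, hUb⟩ := exists_exact_pseudoFlowOnShift_of_apriori_bound hε hω hMα hα hA hD hc S₀ T₀ hT₀ hT₀B
    (fun s hs T hT0 hT t ht => by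
      rcases eq_or_lt_of_le hs.1 with h0 | hspos
      · have ht0 : t = 0 := le_antisymm (h0 ▸ ht.2) ht.1
        subst ht0
        rw [hT0]; exact hT₀B
      · have hstart : ∀ (i : Fin 2) (k : ℤ), T 0 (i, k) = ω k * S₀ i k := fun i k => by rw [hT0]; exact hT₀ i k
        have hflow := pseudoFlowOnShift_of_conjugated hε hω hMα hα hD hspos S₀ hstart hT
        -- the deviation theorem on `[0, s]`
        have hsmall' : (BD + tableAbsSum shiftSetFlat (renormTable ε₀ (mirrorTable ε ε) - mirrorTable ε ε) * (MΦ + 1) * Λ * Mw * s)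
            * Real.exp (2 * tableAbsSum shiftSetFlat (renormTable ε₀ (mirrorTable ε ε)) * (MΦ + 1) * Λ * s) ≤ 1 / 2 :=
          le_trans (mul_le_mul (by nlinarith [hs.2]) (Real.exp_le_exp.mpr (mul_le_mul_of_nonneg_left hs.2 hL0))
            (Real.exp_pos _).le (by nlinarith [hs.1])) hsmall
        have hdev := gauge_deviation_graded_vs_flat hflow hε₀ hs.1 (fun i n => (hΦc i n).mono (Icc_subset_Icc_right hs.2))
          (fun i n u hu => hΦd i n u ⟨hu.1, hu.2.trans_le hs.2⟩) hw hw1 hMΦ hMw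
          (fun i n u hu => hΦb i n u ⟨hu.1, hu.2.trans hs.2⟩) (fun i n u hu => hΦg i n u ⟨hu.1, hu.2.trans hs.2⟩) hBD hsmall'
        refine (norm_le hBnn).2 fun p => ?_
        have hd := (hdev p.1 p.2 t ht).trans
          (le_trans (mul_le_mul (by nlinarith [ht.2]) (Real.exp_le_exp.mpr (mul_le_mul_of_nonneg_left ht.2 hL0))
            (Real.exp_pos _).le (by nlinarith [ht.1])) hsmall')
        have h := hkey t p.1 p.2 (T t (p.1, p.2) / ω p.2) ⟨ht.1, ht.2.trans hs.2⟩ hd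
        rw [abs_div, abs_of_pos (hωpos p.2), mul_div_cancel₀ _ (hωpos p.2).ne'] at h
        rw [Real.norm_eq_abs]
        exact h)
  exact ⟨U, _, hU, hUb⟩

end Summit.NavierStokesRegularity.NavierStokesRegularity.Theorems.HopTube

end
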